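import Literature.NumberTheory.EllipticCurves.IwasawaAlgebraCyclotomicSeparationProofs
import Literature.NumberTheory.EllipticCurves.IwasawaAlgebraGroupRingLimit
import HarnessLib

/-!
# Evaluation of `Λ = ℤ_p⟦X⟧` at a finite-order character `1 + X ↦ ζ` (through the Amice residue modulo
# `ω_N = (1+X)^{p^N} − 1`), the SEMILINEARITY of `(1+X, ℤ_p)`-semilinear value maps on `Λ`-modules for ALL of `Λ`,
# and the kernel `ev_ζ(f) = 0 ⇒ Φ_{p^N}(1+X) ∣ f` (Washington §7.1; Kato §13.9 / Thm. 12.5 (1) «`Σ χ(σ)σ(y)`»)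

Topic `NumberTheory/EllipticCurves`, namespace `Literature.NumberTheory.EllipticCurves.IwasawaAlgebra`.  Typed by seat
`bsd-cm-prr-ty1` g30 (literature-prover, cell bsd-cm) for SUMMON K2C-2 of crux `EllipticUnitValueSevenOfGZK` =
stmt-BirchSwinnertonDyer-19945, input (r4) of the rational half of Kato's (15.16.1)∘15.14 (reading note
`K2cCollapse-g57.md` §2, LEMMA S: «the value functionals satisfy `ℓ_{n,χ}(a·h) = a(χ̃)·ℓ_{n,χ}(h)` for `a ∈ Λ`»).  Two
DEFINITIONS with bodies (`amice`, `charEval`) and their API; proofs only otherwise; no named fact, no instance, no notation.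

## What is here (all `p`)

* `amice p N f : ZMod (p^N) → ℤ_p` — THE Amice residue of `f ∈ Λ` at level `N`: the unique family with
  `ω_N ∣ f − Σ_x amice(x)·(1+X)^x` (tree `IwasawaOmega.existsUnique_omega_dvd_sub_amice`, Washington Prop. 7.2: division
  by the distinguished polynomial `ω_N`; `Λ/ω_N ≅ ℤ_p[ℤ/p^N]`, Thm. 7.1).
* `charEval p ι u N f := Σ_x ι(amice p N f x)·u^x ∈ B` — the value of `f` at the character `1 + X ↦ u` of level `N`
  (`u^{p^N} = 1`), read in a commutative ring `B` through `ι : ℤ_p →+* B` (for the consumer: `B = ℂ`, `ι` a complex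
  reading of `ℤ_7`, `u = χ(γ)⁻¹`); this is `χ`-evaluation of the measure `f` («`∫ χ⁻¹ df`»).
* ★ `val_smul_eq_charEval_mul` — **SEMILINEARITY FOR ALL OF `Λ`**: if `val : M →+ B` on a `Λ`-module `M` satisfies
  `val ((1+X) • m) = u·val m` and `val (C c • m) = ι c·val m` with `u^{p^N} = 1`, then `val (f • m) = charEval(f)·val m`
  for EVERY `f ∈ Λ` (the finite sum by the two axioms; `ω_N` acts by `u^{p^N} − 1 = 0`).
* ★ `coe_cyclotomic_comp_dvd_of_charEval_eq_zero` — **KERNEL**: for a field `B`, `ι : ℚ_p →+* B` and a PRIMITIVE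
  `p^{n+1}`-th root of unity `ζ`, `charEval (ι∘ℤ_p) ζ (n+1) f = 0 ⇒ Φ_{p^{n+1}}(1+X) ∣ f` in `Λ` (the polynomial kernel
  lemma of `IwasawaAlgebraCyclotomicSeparationProofs` + `Φ ∣ ω`).  With `eq_zero_of_infinite_setOf_cyclotomic_dvd` loc.
  cit. this is the separation «`ev_χ(f) = 0` for characters `χ` of infinitely many primitive levels ⇒ `f = 0`».

HONEST FRAMING: commutative algebra of `Λ`; nothing about elliptic curves, dual exponentials or BSD is asserted here (the
value maps are HYPOTHESES `val`); no summit statement is touched; 19945 stays OPEN.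

## References
* L. C. Washington, *Introduction to Cyclotomic Fields* (1997), §7.1 Thm. 7.1, Prop. 7.2; §12.2 (measures and
  `∫ χ dμ`). [Washington1997]
* K. Kato, Astérisque 295 (2004), Thm. 12.5 (1) (p. 221: the functional `x ⊗ y ↦ Σ_{σ∈G_n} χ(σ)σ(y)·per_f(x)`) and §13.9
  (p. 230). [Kato2004Asterisque]
* Tree: `IwasawaAlgebraGroupRingLimit.lean` (`existsUnique_omega_dvd_sub_amice`, `coe_taylor_sum_monomial`),
  `IwasawaAlgebraCyclotomicSeparationProofs.lean` (`cyclotomic_comp_dvd_of_eval_eq_zero`, `coe_cyclotomic_comp_dvd_omega`).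
-/

noncomputable section

open Polynomial

namespace Literature.NumberTheory.EllipticCurves.IwasawaAlgebra

variable (p : ℕ) [hp : Fact p.Prime]

/-! ## §1 The Amice residue of `f ∈ Λ` at level `N` and the evaluation `charEval` -/

/-- **Division by `ω_N`**: every `f ∈ Λ` is `≡ Σ_x a(x)(1+X)^x (mod ω_N)` for a unique `a : ℤ/p^N → ℤ_p`
(tree `IwasawaOmega.existsUnique_omega_dvd_sub_amice` at `S = ℤ_p`). [cite: Washington1997, §7.1 Prop. 7.2] -/
theorem existsUnique_amice (N : ℕ) (f : IwasawaAlgebra p) :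
    ∃! a : ZMod (p ^ N) → ℤ_[p], ((1 + PowerSeries.X : IwasawaAlgebra p) ^ p ^ N - 1) ∣
      f - ∑ x : ZMod (p ^ N), PowerSeries.C (a x) * (1 + PowerSeries.X) ^ x.val :=
  -- `ℤ_p` is `(p)`-adically complete and `(p) ≠ ⊤` (inlined; the tree has these in unrelated / non-importable modules)
  haveI : IsAdicComplete (Ideal.span {(p : ℤ_[p])}) ℤ_[p] := by
    rw [← PadicInt.maximalIdeal_eq_span_p]; infer_instance
  IwasawaOmega.existsUnique_omega_dvd_sub_amice p
    (by rw [Ne, Ideal.span_singleton_eq_top]; exact (PadicInt.irreducible_p (p := p)).not_isUnit) N f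

/-- **`amice p N f`** — the Amice residue of `f` at level `N`: the unique `a : ℤ/p^N → ℤ_p` with
`ω_N ∣ f − Σ_x a(x)(1+X)^x` (the image of `f` in `Λ/ω_N ≅ ℤ_p[ℤ/p^N]`, Washington Thm. 7.1).
[cite: Washington1997, §7.1 Thm. 7.1 and Prop. 7.2] -/
def amice (N : ℕ) (f : IwasawaAlgebra p) : ZMod (p ^ N) → ℤ_[p] :=
  (existsUnique_amice p N f).exists.choose

/-- The defining divisibility `ω_N ∣ f − Σ_x amice(x)(1+X)^x`. [cite: Washington1997, §7.1 Prop. 7.2] -/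
theorem omega_dvd_sub_amice (N : ℕ) (f : IwasawaAlgebra p) :
    ((1 + PowerSeries.X : IwasawaAlgebra p) ^ p ^ N - 1) ∣
      f - ∑ x : ZMod (p ^ N), PowerSeries.C (amice p N f x) * (1 + PowerSeries.X) ^ x.val :=
  (existsUnique_amice p N f).exists.choose_spec

/-- Uniqueness: any family with the defining divisibility IS `amice p N f`. [cite: Washington1997, §7.1 Prop. 7.2] -/
theorem amice_eq_of_omega_dvd (N : ℕ) (f : IwasawaAlgebra p) {a : ZMod (p ^ N) → ℤ_[p]}
    (ha : ((1 + PowerSeries.X : IwasawaAlgebra p) ^ p ^ N - 1) ∣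
      f - ∑ x : ZMod (p ^ N), PowerSeries.C (a x) * (1 + PowerSeries.X) ^ x.val) :
    a = amice p N f :=
  (existsUnique_amice p N f).unique ha (omega_dvd_sub_amice p N f)

/-- **`charEval p ι u N f = Σ_x ι(amice p N f x)·u^x`** — evaluation of `f ∈ Λ` at the character `1 + X ↦ u` of level
`N`, read in `B` through `ι : ℤ_p →+* B` (`∫ χ⁻¹ df` for `u = χ(γ)⁻¹`). [cite: Washington1997, §12.2 (p. 238) and §7.1 Thm. 7.1] -/
def charEval {B : Type*} [CommRing B] (ι : ℤ_[p] →+* B) (u : B) (N : ℕ) (f : IwasawaAlgebra p) : B :=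
  ∑ x : ZMod (p ^ N), ι (amice p N f x) * u ^ x.val

/-- Unfolding `charEval`. [cite: Washington1997, §12.2 (p. 238)] -/
theorem charEval_def {B : Type*} [CommRing B] (ι : ℤ_[p] →+* B) (u : B) (N : ℕ) (f : IwasawaAlgebra p) :
    charEval p ι u N f = ∑ x : ZMod (p ^ N), ι (amice p N f x) * u ^ x.val := rfl

/-! ## §2 Semilinearity of `(1+X, ℤ_p)`-semilinear value maps for ALL of `Λ` -/

section Semilinear

variable {p}
variable {M B : Type*} [AddCommGroup M] [Module (IwasawaAlgebra p) M] [CommRing B]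
  {ι : ℤ_[p] →+* B} {u : B} {val : M →+ B}

/-- `val ((1+X)^k • m) = u^k·val m`. [cite: Kato2004Asterisque, Thm. 12.5 (1) (p. 221)] -/
theorem val_onePlusX_pow_smul (hT : ∀ m, val ((1 + PowerSeries.X : IwasawaAlgebra p) • m) = u * val m)
    (k : ℕ) (m : M) : val (((1 + PowerSeries.X : IwasawaAlgebra p) ^ k) • m) = u ^ k * val m := by
  induction k generalizing m with
  | zero => rw [pow_zero, one_smul, pow_zero, one_mul]
  | succ k ih => rw [pow_succ, mul_smul, ih, hT, pow_succ]; ring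

/-- `val` of a finite Amice sum: `val ((Σ_x C(a x)(1+X)^x) • m) = (Σ_x ι(a x) u^x)·val m`.
[cite: Washington1997, §7.1 Thm. 7.1] -/
theorem val_amiceSum_smul (hT : ∀ m, val ((1 + PowerSeries.X : IwasawaAlgebra p) • m) = u * val m)
    (hC : ∀ (c : ℤ_[p]) (m : M), val (PowerSeries.C c • m) = ι c * val m)
    {N : ℕ} (a : ZMod (p ^ N) → ℤ_[p]) (m : M) :
    val ((∑ x : ZMod (p ^ N), PowerSeries.C (a x) * (1 + PowerSeries.X) ^ x.val) • m) =
      (∑ x : ZMod (p ^ N), ι (a x) * u ^ x.val) * val m := by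
  rw [Finset.sum_smul, map_sum, Finset.sum_mul]
  refine Finset.sum_congr rfl fun x _ => ?_
  rw [mul_smul, hC, val_onePlusX_pow_smul hT, mul_assoc]

/-- `ω_N = (1+X)^{p^N} − 1` kills values at level `N`: `val ((ω_N·q) • m) = 0` when `u^{p^N} = 1`.
[cite: Washington1997, §7.1 Thm. 7.1] -/
theorem val_omega_mul_smul (hT : ∀ m, val ((1 + PowerSeries.X : IwasawaAlgebra p) • m) = u * val m)
    {N : ℕ} (hu : u ^ p ^ N = 1) (q : IwasawaAlgebra p) (m : M) :
    val ((((1 + PowerSeries.X : IwasawaAlgebra p) ^ p ^ N - 1) * q) • m) = 0 := by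
  rw [mul_smul, sub_smul, one_smul, map_sub, val_onePlusX_pow_smul hT, hu, one_mul, sub_self]

/-- ★ **Semilinearity for ALL of `Λ`**: `val (f • m) = charEval(f)·val m` for every `f ∈ Λ = ℤ_p⟦X⟧`, granted the
two generator axioms `val ((1+X) • m) = u·val m`, `val (C c • m) = ι c·val m` and `u^{p^N} = 1` — Kato's «`ℓ(a·h) =
a(χ)·ℓ(h)` for `a ∈ Λ`» through the Amice residue. [cite: Kato2004Asterisque, Thm. 12.5 (1) (p. 221) and §13.9 (p. 230)]
[cite: Washington1997, §7.1 Prop. 7.2] -/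
theorem val_smul_eq_charEval_mul (hT : ∀ m, val ((1 + PowerSeries.X : IwasawaAlgebra p) • m) = u * val m)
    (hC : ∀ (c : ℤ_[p]) (m : M), val (PowerSeries.C c • m) = ι c * val m)
    {N : ℕ} (hu : u ^ p ^ N = 1) (f : IwasawaAlgebra p) (m : M) :
    val (f • m) = charEval p ι u N f * val m := by
  obtain ⟨q, hq⟩ := omega_dvd_sub_amice p N f
  have hf : f = ((1 + PowerSeries.X : IwasawaAlgebra p) ^ p ^ N - 1) * q +
      ∑ x : ZMod (p ^ N), PowerSeries.C (amice p N f x) * (1 + PowerSeries.X) ^ x.val := by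
    rw [← hq, sub_add_cancel]
  have h1 : val (f • m) = val ((((1 + PowerSeries.X : IwasawaAlgebra p) ^ p ^ N - 1) * q +
      ∑ x : ZMod (p ^ N), PowerSeries.C (amice p N f x) * (1 + PowerSeries.X) ^ x.val) • m) := by
    rw [← hf]
  rw [h1, add_smul, map_add, val_omega_mul_smul hT hu, zero_add, val_amiceSum_smul hT hC, charEval_def]

/-- Products: `val ((f·g) • m) = charEval(f)·charEval(g)·val m`. [cite: Kato2004Asterisque, §13.9 (p. 230)] -/
theorem val_mul_smul_eq (hT : ∀ m, val ((1 + PowerSeries.X : IwasawaAlgebra p) • m) = u * val m)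
    (hC : ∀ (c : ℤ_[p]) (m : M), val (PowerSeries.C c • m) = ι c * val m)
    {N : ℕ} (hu : u ^ p ^ N = 1) (f g : IwasawaAlgebra p) (m : M) :
    val ((f * g) • m) = charEval p ι u N f * charEval p ι u N g * val m := by
  rw [mul_smul, val_smul_eq_charEval_mul hT hC hu, val_smul_eq_charEval_mul hT hC hu, mul_assoc]

end Semilinear

/-! ## §3 The kernel: `charEval_ζ(f) = 0 ⇒ Φ_{p^{n+1}}(1+X) ∣ f` for a primitive `ζ` -/

/-- The Amice polynomial `Σ_x a(x)·Y^x`, shifted by `Y = X + 1`, coerces to the Amice sum in `Λ`.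
[cite: Washington1997, §7.1 Thm. 7.1] -/
theorem coe_sum_monomial_comp {N : ℕ} (a : ZMod (p ^ N) → ℤ_[p]) :
    (((∑ x : ZMod (p ^ N), monomial x.val (a x)).comp (X + 1) : ℤ_[p][X]) : IwasawaAlgebra p) =
      ∑ x : ZMod (p ^ N), PowerSeries.C (a x) * (1 + PowerSeries.X) ^ x.val := by
  rw [← IwasawaOmega.coe_taylor_sum_monomial, Polynomial.taylor_apply, map_one]

/-- Evaluating the shifted Amice polynomial at `ζ − 1` through `ι` gives `charEval`. [cite: Washington1997, §12.2 (p. 238)] -/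
theorem eval_map_sum_monomial_comp {B : Type*} [CommRing B] (ι : ℤ_[p] →+* B) (ζ : B) {N : ℕ}
    (a : ZMod (p ^ N) → ℤ_[p]) :
    (((∑ x : ZMod (p ^ N), monomial x.val (a x)).comp (X + 1)).map ι).eval (ζ - 1) =
      ∑ x : ZMod (p ^ N), ι (a x) * ζ ^ x.val := by
  rw [Polynomial.map_comp, Polynomial.map_add, map_X, Polynomial.map_one, eval_comp, eval_add, eval_X, eval_one,
    sub_add_cancel, Polynomial.map_sum, eval_finsetSum]
  refine Finset.sum_congr rfl fun x _ => ?_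
  rw [map_monomial, eval_monomial]

/-- ★ **Kernel of `charEval` at a primitive root**: for a field `B`, `ι : ℚ_p →+* B`, a PRIMITIVE `p^{n+1}`-th root of
unity `ζ ∈ B` and `f ∈ Λ`: if `charEval (ι∘ℤ_p) ζ (n+1) f = 0` then `Φ_{p^{n+1}}(1+X) ∣ f` in `Λ` (the Amice polynomial
vanishes at `ζ`, so `Φ_{p^{n+1}}(Y) ∣` it by irreducibility over `ℚ_p`; and `Φ_{p^{n+1}}(1+X) ∣ ω_{n+1} ∣ f − residue`).
[cite: Washington1997, §7.1 Prop. 7.2] [cite: SerreLocalFields1979, IV §4 Prop 17] -/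
theorem coe_cyclotomic_comp_dvd_of_charEval_eq_zero (n : ℕ) {B : Type*} [Field B] (ι : ℚ_[p] →+* B) {ζ : B}
    (hζ : IsPrimitiveRoot ζ (p ^ (n + 1))) {f : IwasawaAlgebra p}
    (h : charEval p (ι.comp (algebraMap ℤ_[p] ℚ_[p])) ζ (n + 1) f = 0) :
    ((((cyclotomic (p ^ (n + 1)) ℤ).comp (X + 1)).map (Int.castRingHom ℤ_[p]) : ℤ_[p][X]) : IwasawaAlgebra p) ∣ f := by
  set a := amice p (n + 1) f with ha
  have hP : ((((∑ x : ZMod (p ^ (n + 1)), monomial x.val (a x)).comp (X + 1)).map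
      (ι.comp (algebraMap ℤ_[p] ℚ_[p]))).eval (ζ - 1) = 0) := by
    rw [eval_map_sum_monomial_comp, ← charEval_def]
    exact h
  have hdvdP := cyclotomic_comp_dvd_of_eval_eq_zero p n ι hζ hP
  have h1 : ((((cyclotomic (p ^ (n + 1)) ℤ).comp (X + 1)).map (Int.castRingHom ℤ_[p]) : ℤ_[p][X]) :
      IwasawaAlgebra p) ∣ ∑ x : ZMod (p ^ (n + 1)), PowerSeries.C (a x) * (1 + PowerSeries.X) ^ x.val := by
    rw [← coe_sum_monomial_comp]
    obtain ⟨Q, hQ⟩ := hdvdP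
    exact ⟨(Q : IwasawaAlgebra p), by rw [hQ, Polynomial.coe_mul]⟩
  have h2 := (coe_cyclotomic_comp_dvd_omega p n).trans (omega_dvd_sub_amice p (n + 1) f)
  have h3 := dvd_add h2 h1
  rwa [sub_add_cancel] at h3

/-- ★★ **Separation of scalars by characters**: if `charEval (ι∘ℤ_p) ζ_n (n+1) f = 0` for primitive `p^{n+1}`-th roots
`ζ_n ∈ B` for infinitely many `n`, then `f = 0`. [cite: Kato2004Asterisque, §13.9 (p. 230 l. 8–9)] [cite: Washington1997, Thm. 7.3] -/
theorem eq_zero_of_infinite_setOf_charEval_eq_zero {B : Type*} [Field B] (ι : ℚ_[p] →+* B) (ζ : ℕ → B)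
    (hζ : ∀ n, IsPrimitiveRoot (ζ n) (p ^ (n + 1))) {f : IwasawaAlgebra p}
    (hinf : {n : ℕ | charEval p (ι.comp (algebraMap ℤ_[p] ℚ_[p])) (ζ n) (n + 1) f = 0}.Infinite) : f = 0 :=
  eq_zero_of_infinite_setOf_cyclotomic_dvd p
    (hinf.mono fun n hn => coe_cyclotomic_comp_dvd_of_charEval_eq_zero p n ι (hζ n) hn)

end Literature.NumberTheory.EllipticCurves.IwasawaAlgebra

end
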